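import Summits.AtomisticToContinuum.Crystallization.Theorems.OverbindingBudgetAffineFarCoreWindows

/-!
# Pattern rigidity, CORE: granularity of integer Barlow combinations, isotropy ⇒ isometry, and the abstract rigidity theorem
# (decomp-a2c lens-4, generation 66, Deliverable D1; critic row 1101 (iii) item (iv) `PatternRigid (2/5) τ`)

Imports ONLY g65 `…FarCoreWindows` (for the vocabulary `PatternRigid`, `idxPos`, `twoShellIdx`; transitively the tree's `…TwoShellWindow` and
`Literature…TwoShellPatterns`).  Everything here is PROVED (0 sorry, axioms `[propext, Classical.choice, Quot.sound]`).

The [FINITE] leaf (iv) of the Z2 record (`farCoreExcess_record_of_farWindowData`, hypothesis `PatternRigid (2/5) τ`) asked for an "exact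
enumeration over `ℤ[√2,√3]`".  It is proved here and in `…PatternRigid` (D2) WITHOUT enumeration, by three soft facts:
* §R1 GRANULARITY `IsBarlowInt.norm_sq_ge`: a non-zero `ℤ`-combination of `t₁, t₂, w, √(2/3)e₃` has `‖u‖² ≥ 1/12` (so `‖u‖ < 1/4 ⇒ u = 0`);
  every structure point of every normalised Barlow stacking is such a combination (`isBarlowInt_barlowPos`).
* §R2 ISOTROPY ⇒ ISOMETRY `norm_map_eq_of_isotropic`: if `Σ_{v∈P}⟪v,x⟫² = c‖x‖²` and `Σ_{v∈P}⟪Mv,y⟫² = c‖y‖²` then `‖Mx‖ = ‖x‖`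
  (adjoint: `‖M†y‖ = ‖y‖`, then Cauchy–Schwarz both ways, `M†` injective ⇒ surjective in finite dimension).
* §R3 ★ `rigid_core`: for a finite `P` with second moment `8·id`, a basis `b ⊂ P` with `q·v ∈ Σ ℤ bᵢ`, `ℓ¹`-size `≤ C` (`v ∈ P`), and integer
  Barlow targets `T = f(I)`, `|I| ≤ |P|`, second moment `8·id`: if `‖Xu‖ ≥ (3/5)‖u‖`, `φ : P ↪ T` and `‖X(φv) − A₀v‖ ≤ τ₀` with
  `(5/3)(q+C)τ₀ < 1/4`, then `φ = R|_P` for a linear isometry `R` — granularity makes `φ` the restriction of the linear `M'` with `M'bᵢ = φbᵢ`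
  (`‖X(qφv − Σcᵢφbᵢ)‖ ≤ (q+C)τ₀`), counting gives `M'(P) = T` and `f` injective on `I`, isotropy transfers and §R2 concludes.
D2 supplies the two coordinate tables (`decide`), the four second-moment identities (`ring`/`linear_combination`) and the theorem
`patternRigid_two_fifths : PatternRigid (2/5) (1/100)`.
-/

namespace Summit.AtomisticToContinuum.Crystallization.Theorems.OverbindingBudgetAffineFarSmoothSplit

open scoped BigOperators Classical InnerProductSpace
open Literature.MathematicalPhysics.StatisticalMechanics Literature.Geometry.DiscreteGeometry

local notation "E3" => EuclideanSpace ℝ (Fin 3)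

namespace PatternRigidProof

/-! ## §R0 Coordinates (local copies, so that this file depends on `…FarCoreWindows` only) -/

/-- `normSq_coords` (docstring added by the landing lane; see the module docstring). [formal bookkeeping] (dedup gate: public twins Literature.Geometry.Lorentzian.E3.norm_sq / …Kerr.Ingoing.inner_e3 / …CLayerWitnessLayering.haggLabel_one / …PrestressSplitKorn.haggLabel_neg_one live in unrelated modules; kept PRIVATE here) -/
private theorem normSq_coords (v : E3) : ‖v‖ ^ 2 = v 0 ^ 2 + v 1 ^ 2 + v 2 ^ 2 := by
  rw [EuclideanSpace.norm_eq, Real.sq_sqrt (Finset.sum_nonneg fun i _ => by positivity), Fin.sum_univ_three]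
  simp only [Real.norm_eq_abs, sq_abs]

/-- `inner_coords` (docstring added by the landing lane; see the module docstring). [formal bookkeeping] (dedup gate: public twins Literature.Geometry.Lorentzian.E3.norm_sq / …Kerr.Ingoing.inner_e3 / …CLayerWitnessLayering.haggLabel_one / …PrestressSplitKorn.haggLabel_neg_one live in unrelated modules; kept PRIVATE here) -/
private theorem inner_coords (v w : E3) : ⟪v, w⟫_ℝ = v 0 * w 0 + v 1 * w 1 + v 2 * w 2 := by
  rw [PiLp.inner_apply, Fin.sum_univ_three]
  simp only [RCLike.inner_apply, conj_trivial]
  ring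

/-- `label_one` (docstring added by the landing lane; see the module docstring). [formal bookkeeping] (dedup gate: public twins Literature.Geometry.Lorentzian.E3.norm_sq / …Kerr.Ingoing.inner_e3 / …CLayerWitnessLayering.haggLabel_one / …PrestressSplitKorn.haggLabel_neg_one live in unrelated modules; kept PRIVATE here) -/
private theorem label_one (s : ℤ → ℤ) : haggLabel s 1 = s 0 := by simpa using haggLabel_succ s 0

/-- `label_neg_one` (docstring added by the landing lane; see the module docstring). [formal bookkeeping] (dedup gate: public twins Literature.Geometry.Lorentzian.E3.norm_sq / …Kerr.Ingoing.inner_e3 / …CLayerWitnessLayering.haggLabel_one / …PrestressSplitKorn.haggLabel_neg_one live in unrelated modules; kept PRIVATE here) -/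
private theorem label_neg_one (s : ℤ → ℤ) : haggLabel s (-1) = -s (-1) := by
  have h := haggLabel_succ s (-1)
  simp at h
  linarith

/-! ## §R1 Integer Barlow combinations and their granularity -/

-- REVIEWER REVISION (p850558, landing lane hand-2 g31): the seat's bespoke ∃-predicate `IsBarlowInt` and its seven closure lemmas are
-- replaced by MEMBERSHIP IN A `ℤ`-SPAN (Mathlib `Submodule.span`, the vocabulary of `Literature…BarlowStacking.barlowPeriodLattice`);
-- closure under `0, +, −, n•` is now `Submodule.zero_mem/add_mem/sub_mem`, `nsmul_mem`, `zsmul_mem`; the explicit four-integer form is `isBarlowInt_iff`.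

/-- The four structure vectors `t₁, t₂, w = (t₁+t₂)/3, n = √(2/3)·e₃` of the normalised Barlow stackings. [this file] -/
noncomputable def barlowGens : Fin 4 → E3 :=
  ![triangularVec₁ 1, triangularVec₂ 1, barlowOffset 1, layerNormal (Real.sqrt (2 / 3))]

/-- The ENVELOPE LATTICE of the normalised Barlow stackings: the `ℤ`-span of the four structure vectors (every normalised Barlow
stacking's point set lies in it, `isBarlowInt_barlowPos`). [this file] -/
noncomputable def barlowEnvelope : Submodule ℤ E3 := Submodule.span ℤ (Set.range barlowGens)

/-- `u` is an integer Barlow combination: membership in the envelope lattice `barlowEnvelope`. [this file] -/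
abbrev IsBarlowInt (u : E3) : Prop := u ∈ barlowEnvelope

/-- The explicit four-integer form of membership in the envelope lattice. [this file] -/
theorem isBarlowInt_iff {u : E3} : IsBarlowInt u ↔ ∃ a b c d : ℤ, u = (a : ℝ) • triangularVec₁ 1 + (b : ℝ) • triangularVec₂ 1 +
    (c : ℝ) • barlowOffset 1 + (d : ℝ) • layerNormal (Real.sqrt (2 / 3)) := by
  rw [IsBarlowInt, barlowEnvelope, Submodule.mem_span_range_iff_exists_fun]
  constructor
  · rintro ⟨c, rfl⟩
    refine ⟨c 0, c 1, c 2, c 3, ?_⟩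
    simp only [Fin.sum_univ_four, barlowGens, Matrix.cons_val_zero, Matrix.cons_val_one, Matrix.cons_val_two,
      Matrix.cons_val_three, Matrix.head_cons, Matrix.tail_cons, Int.cast_smul_eq_zsmul]
  · rintro ⟨a, b, c, d, rfl⟩
    refine ⟨![a, b, c, d], ?_⟩
    simp only [Fin.sum_univ_four, barlowGens, Matrix.cons_val_zero, Matrix.cons_val_one, Matrix.cons_val_two,
      Matrix.cons_val_three, Matrix.head_cons, Matrix.tail_cons, Int.cast_smul_eq_zsmul]

/-- Every structure point of a normalised Barlow stacking is an integer Barlow combination. [this file] -/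
theorem isBarlowInt_barlowPos (s : ℤ → ℤ) (k i j : ℤ) : IsBarlowInt (barlowPos 1 (Real.sqrt (2 / 3)) s k i j) :=
  isBarlowInt_iff.2 ⟨i, j, haggLabel s k, k, rfl⟩

/-- `isBarlowInt_idxPos` (docstring added by the landing lane; see the module docstring). [formal bookkeeping] -/
theorem isBarlowInt_idxPos (s : ℤ → ℤ) (t : ℤ × ℤ × ℤ) : IsBarlowInt (idxPos s t) := isBarlowInt_barlowPos s _ _ _

/-- Coordinates of an integer Barlow combination. [this file] -/
theorem isBarlowInt_coords (a b c d : ℤ) :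
    let u : E3 := (a : ℝ) • triangularVec₁ 1 + (b : ℝ) • triangularVec₂ 1 + (c : ℝ) • barlowOffset 1 +
      (d : ℝ) • layerNormal (Real.sqrt (2 / 3))
    u 0 = (2 * a + b + c : ℝ) / 2 ∧ u 1 = (3 * b + c : ℝ) * (Real.sqrt 3 / 6) ∧ u 2 = (d : ℝ) * Real.sqrt (2 / 3) := by
  refine ⟨?_, ?_, ?_⟩ <;> simp [triangularVec₁, triangularVec₂, barlowOffset, layerNormal] <;> ring

/-- ★ GRANULARITY: a non-zero integer Barlow combination has `‖u‖² ≥ 1/12`. [this file] -/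
theorem IsBarlowInt.norm_sq_ge {u : E3} (hu : IsBarlowInt u) (h0 : u ≠ 0) : 1 / 12 ≤ ‖u‖ ^ 2 := by
  obtain ⟨a, b, c, d, rfl⟩ := isBarlowInt_iff.1 hu
  obtain ⟨h0', h1', h2'⟩ := isBarlowInt_coords a b c d
  have h3 : Real.sqrt 3 ^ 2 = 3 := Real.sq_sqrt (by norm_num)
  have h23 : Real.sqrt (2 / 3) ^ 2 = 2 / 3 := Real.sq_sqrt (by norm_num)
  have e1 : ((3 * b + c : ℝ) * (Real.sqrt 3 / 6)) ^ 2 = (3 * b + c : ℝ) ^ 2 / 12 := by rw [mul_pow, div_pow, h3]; ring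
  have e2 : ((d : ℝ) * Real.sqrt (2 / 3)) ^ 2 = (d : ℝ) ^ 2 * (2 / 3) := by rw [mul_pow, h23]
  have hn : ‖(a : ℝ) • triangularVec₁ 1 + (b : ℝ) • triangularVec₂ 1 + (c : ℝ) • barlowOffset 1 +
      (d : ℝ) • layerNormal (Real.sqrt (2 / 3))‖ ^ 2 = ((2 * a + b + c : ℝ) / 2) ^ 2 + (3 * b + c : ℝ) ^ 2 / 12 + (d : ℝ) ^ 2 * (2 / 3) := by
    rw [normSq_coords, h0', h1', h2', e1, e2]
  rw [hn]
  have hsq : ∀ n : ℤ, n ≠ 0 → (1 : ℝ) ≤ (n : ℝ) ^ 2 := fun n hn0 => by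
    have hz : (1 : ℤ) ≤ |n| := Int.one_le_abs hn0
    have h1 : (1 : ℝ) ≤ |(n : ℝ)| := by exact_mod_cast hz
    nlinarith [abs_nonneg (n : ℝ), sq_abs (n : ℝ)]
  by_cases hd : d = 0
  · by_cases hbc : 3 * b + c = 0
    · by_cases habc : 2 * a + b + c = 0
      · exfalso; apply h0
        have ha' : (2 * a + b + c : ℝ) = 0 := by exact_mod_cast habc
        have hb' : (3 * b + c : ℝ) = 0 := by exact_mod_cast hbc
        have hd' : (d : ℝ) = 0 := by exact_mod_cast hd
        have : ‖(a : ℝ) • triangularVec₁ 1 + (b : ℝ) • triangularVec₂ 1 + (c : ℝ) • barlowOffset 1 +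
            (d : ℝ) • layerNormal (Real.sqrt (2 / 3))‖ ^ 2 = 0 := by rw [hn, ha', hb', hd']; ring
        exact norm_eq_zero.1 ((pow_eq_zero_iff two_ne_zero).1 this)
      · have h1 := hsq _ habc
        push_cast at h1
        nlinarith [sq_nonneg (3 * b + c : ℝ), sq_nonneg (d : ℝ)]
    · have h1 := hsq _ hbc
      push_cast at h1
      nlinarith [sq_nonneg ((2 * a + b + c : ℝ) / 2), sq_nonneg (d : ℝ)]
  · have h1 := hsq _ hd
    nlinarith [sq_nonneg ((2 * a + b + c : ℝ) / 2), sq_nonneg (3 * b + c : ℝ)]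

/-- Hence: an integer Barlow combination of norm `< 1/4` vanishes. [this file] -/
theorem IsBarlowInt.eq_zero_of_norm_lt {u : E3} (hu : IsBarlowInt u) (h : ‖u‖ < 1 / 4) : u = 0 := by
  by_contra h0
  have := hu.norm_sq_ge h0
  nlinarith [norm_nonneg u]

/-! ## §R2 Second-moment isotropy makes a configuration-preserving linear map an isometry -/

/-- If `Σ_{v∈P} ⟪v,x⟫² = c‖x‖²` and `Σ_{v∈P} ⟪M v,y⟫² = c‖y‖²` for all `x, y` (`c > 0`), then `M` is a linear isometry. [this file] -/
theorem norm_map_eq_of_isotropic {P : Finset E3} (M : E3 →ₗ[ℝ] E3) {c : ℝ} (hc : 0 < c)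
    (hP : ∀ x : E3, ∑ v ∈ P, ⟪v, x⟫_ℝ ^ 2 = c * ‖x‖ ^ 2) (hMP : ∀ y : E3, ∑ v ∈ P, ⟪M v, y⟫_ℝ ^ 2 = c * ‖y‖ ^ 2) (x : E3) :
    ‖M x‖ = ‖x‖ := by
  have hadj : ∀ y : E3, ‖LinearMap.adjoint M y‖ = ‖y‖ := by
    intro y
    have h1 : ∑ v ∈ P, ⟪M v, y⟫_ℝ ^ 2 = c * ‖LinearMap.adjoint M y‖ ^ 2 := by
      rw [← hP]; refine Finset.sum_congr rfl fun v _ => ?_; rw [LinearMap.adjoint_inner_right]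
    have h2 : ‖LinearMap.adjoint M y‖ ^ 2 = ‖y‖ ^ 2 := by
      have := hMP y; rw [h1] at this; exact mul_left_cancel₀ hc.ne' this
    exact (pow_left_inj₀ (norm_nonneg _) (norm_nonneg _) two_ne_zero).1 h2
  have hle : ∀ z : E3, ‖M z‖ ≤ ‖z‖ := by
    intro z
    have h1 : ‖M z‖ ^ 2 ≤ ‖z‖ * ‖M z‖ := by
      calc ‖M z‖ ^ 2 = ⟪M z, M z⟫_ℝ := (real_inner_self_eq_norm_sq _).symm
        _ = ⟪z, LinearMap.adjoint M (M z)⟫_ℝ := by rw [LinearMap.adjoint_inner_right]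
        _ ≤ ‖z‖ * ‖LinearMap.adjoint M (M z)‖ := real_inner_le_norm _ _
        _ = ‖z‖ * ‖M z‖ := by rw [hadj]
    nlinarith [norm_nonneg (M z), norm_nonneg z]
  have hge : ∀ z : E3, ‖z‖ ≤ ‖M z‖ := by
    intro z
    have hinj : Function.Injective (LinearMap.adjoint M) := by
      intro y₁ y₂ h
      have : ‖LinearMap.adjoint M (y₁ - y₂)‖ = 0 := by rw [map_sub, h, sub_self, norm_zero]
      rw [hadj, norm_eq_zero, sub_eq_zero] at this
      exact this
    obtain ⟨y, hy⟩ := (LinearMap.injective_iff_surjective.1 hinj) z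
    have h1 : ‖z‖ ^ 2 ≤ ‖M z‖ * ‖z‖ := by
      calc ‖z‖ ^ 2 = ⟪z, z⟫_ℝ := (real_inner_self_eq_norm_sq _).symm
        _ = ⟪z, LinearMap.adjoint M y⟫_ℝ := by rw [hy]
        _ = ⟪M z, y⟫_ℝ := LinearMap.adjoint_inner_right _ _ _
        _ ≤ ‖M z‖ * ‖y‖ := real_inner_le_norm _ _
        _ = ‖M z‖ * ‖z‖ := by rw [← hadj y, hy]
    nlinarith [norm_nonneg (M z), norm_nonneg z]
  exact le_antisymm (hle x) (hge x)

/-! ## §R3 The core rigidity theorem -/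

/-- ★ CORE.  Let `P ⊂ E3` be a finite configuration with second moment `Σ_{v∈P} ⟪v,x⟫² = 8‖x‖²`, containing a basis `b` over which every
`q·v` (`v ∈ P`) has integer coordinates of `ℓ¹`-size `≤ C`; let `T = f(I)` be integer Barlow combinations with `|I| ≤ |P|` and the same second
moment.  If `X` is `3/5`-bounded below, `π : P → T` is injective and `‖X(π v) − A₀ v‖ ≤ τ₀` with `(5/3)(q + C)τ₀ < 1/4`, then `π` is the
restriction of a linear isometry.  (Granularity forces `π = M'` linear; counting forces `M'(P) = T`; isotropy forces `M'` orthogonal.) [this file] -/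
theorem rigid_core {ι : Type*} (P : Finset E3) (I : Finset ι) (f : ι → E3) (hIP : I.card ≤ P.card)
    (b : Fin 3 → E3) (hb : LinearIndependent ℝ b) (hbP : ∀ i, b i ∈ P) (q : ℕ) (hq : q ≠ 0) (C : ℕ)
    (hcoef : ∀ v ∈ P, ∃ c : Fin 3 → ℤ, (q : ℝ) • v = ∑ i, (c i : ℝ) • b i ∧ ∑ i, |c i| ≤ (C : ℤ))
    (hT : ∀ i ∈ I, IsBarlowInt (f i))
    (hPiso : ∀ x : E3, ∑ v ∈ P, ⟪v, x⟫_ℝ ^ 2 = 8 * ‖x‖ ^ 2) (hTiso : ∀ y : E3, ∑ i ∈ I, ⟪f i, y⟫_ℝ ^ 2 = 8 * ‖y‖ ^ 2)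
    {X A₀ : E3 →ₗ[ℝ] E3} (hX : ∀ u, 3 / 5 * ‖u‖ ≤ ‖X u‖) {τ₀ : ℝ} (hτ : 5 / 3 * ((q : ℝ) + C) * τ₀ < 1 / 4)
    {φ : E3 → E3} (hπT : ∀ v ∈ P, φ v ∈ I.image f) (hπA : ∀ v ∈ P, ‖X (φ v) - A₀ v‖ ≤ τ₀) (hinj : Set.InjOn φ ↑P) :
    ∃ R : E3 →ₗᵢ[ℝ] E3, ∀ v ∈ P, φ v = R v := by
  classical
  -- the linear candidate `M'` with `M' bᵢ = φ bᵢ`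
  let B : Module.Basis (Fin 3) ℝ E3 :=
    basisOfLinearIndependentOfCardEqFinrank hb (by rw [finrank_euclideanSpace_fin, Fintype.card_fin])
  have hB : ⇑B = b := coe_basisOfLinearIndependentOfCardEqFinrank _ _
  let M : E3 →ₗ[ℝ] E3 := B.constr ℝ fun i => φ (b i)
  have hMb : ∀ i, M (b i) = φ (b i) := fun i => by
    have h := B.constr_basis ℝ (fun i => φ (b i)) i
    rwa [hB] at h
  have hτ0 : ∀ v ∈ P, 0 ≤ τ₀ := fun v hv => (norm_nonneg _).trans (hπA v hv)
  have hπI : ∀ v ∈ P, IsBarlowInt (φ v) := fun v hv => by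
    obtain ⟨i, hi, h⟩ := Finset.mem_image.1 (hπT v hv)
    rw [← h]; exact hT i hi
  -- granularity: `φ v = M' v` on `P`
  have hπM : ∀ v ∈ P, φ v = M v := by
    intro v hv
    obtain ⟨c, hcv, hcC⟩ := hcoef v hv
    set w : E3 := (q : ℝ) • φ v - ∑ i, (c i : ℝ) • φ (b i) with hw
    have hwI : IsBarlowInt w := by
      have h1 : ((q : ℝ) • φ v) ∈ barlowEnvelope := by rw [Nat.cast_smul_eq_nsmul]; exact nsmul_mem (hπI v hv) q
      have h2 : (∑ i, (c i : ℝ) • φ (b i)) ∈ barlowEnvelope :=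
        Submodule.sum_mem _ fun i _ => by rw [Int.cast_smul_eq_zsmul]; exact zsmul_mem (hπI _ (hbP i)) (c i)
      exact Submodule.sub_mem _ h1 h2
    have hA : (q : ℝ) • A₀ v = ∑ i, (c i : ℝ) • A₀ (b i) := by
      rw [← map_smul, hcv, map_sum]; simp only [map_smul]
    have hXw : X w = (q : ℝ) • (X (φ v) - A₀ v) - ∑ i, (c i : ℝ) • (X (φ (b i)) - A₀ (b i)) := by
      simp only [hw, map_sub, map_smul, map_sum, smul_sub, Finset.sum_sub_distrib, ← hA]
      abel
    have hXn : ‖X w‖ ≤ ((q : ℝ) + C) * τ₀ := by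
      rw [hXw]
      have h1 : ‖(q : ℝ) • (X (φ v) - A₀ v)‖ ≤ (q : ℝ) * τ₀ := by
        rw [norm_smul, Real.norm_natCast]; exact mul_le_mul_of_nonneg_left (hπA v hv) (Nat.cast_nonneg _)
      have h2 : ‖∑ i, (c i : ℝ) • (X (φ (b i)) - A₀ (b i))‖ ≤ (C : ℝ) * τ₀ := by
        refine (norm_sum_le _ _).trans ?_
        have h3 : ∀ i, ‖(c i : ℝ) • (X (φ (b i)) - A₀ (b i))‖ ≤ (|c i| : ℤ) * τ₀ := fun i => by
          rw [norm_smul, Int.cast_abs, ← Real.norm_eq_abs]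
          exact mul_le_mul_of_nonneg_left (hπA _ (hbP i)) (norm_nonneg _)
        refine (Finset.sum_le_sum fun i _ => h3 i).trans ?_
        rw [← Finset.sum_mul]
        refine mul_le_mul_of_nonneg_right ?_ (hτ0 v hv)
        exact_mod_cast hcC
      calc _ ≤ ‖(q : ℝ) • (X (φ v) - A₀ v)‖ + ‖∑ i, (c i : ℝ) • (X (φ (b i)) - A₀ (b i))‖ := norm_sub_le _ _
        _ ≤ (q : ℝ) * τ₀ + (C : ℝ) * τ₀ := add_le_add h1 h2
        _ = ((q : ℝ) + C) * τ₀ := by ring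
    have hwn : ‖w‖ < 1 / 4 := by
      have := hX w
      nlinarith
    have hw0 : w = 0 := hwI.eq_zero_of_norm_lt hwn
    have hqM : (q : ℝ) • φ v = (q : ℝ) • M v := by
      have h1 : (q : ℝ) • φ v = ∑ i, (c i : ℝ) • φ (b i) := sub_eq_zero.1 (by rw [← hw]; exact hw0)
      rw [h1, ← map_smul, hcv, map_sum]
      simp only [map_smul, hMb]
    exact smul_right_injective E3 (Nat.cast_ne_zero.2 hq) hqM
  -- counting: `M'(P) = T`, and `f` is injective on `I`
  have hinjM : Set.InjOn M ↑P := fun v hv v' hv' h => hinj hv hv' (by rw [hπM v hv, hπM v' hv']; exact h)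
  have hsub : P.image M ⊆ I.image f := Finset.image_subset_iff.2 fun v hv => by rw [← hπM v hv]; exact hπT v hv
  have hcardPM : (P.image M).card = P.card := Finset.card_image_of_injOn hinjM
  have heq : P.image M = I.image f :=
    Finset.eq_of_subset_of_card_le hsub (by rw [hcardPM]; exact Finset.card_image_le.trans hIP)
  have hcardI : (I.image f).card = I.card :=
    le_antisymm Finset.card_image_le (by rw [← heq, hcardPM]; exact hIP)
  have hinjf : Set.InjOn f ↑I := Finset.card_image_iff.1 hcardI
  -- isotropy transfer and conclusion
  have hMiso : ∀ y : E3, ∑ v ∈ P, ⟪M v, y⟫_ℝ ^ 2 = 8 * ‖y‖ ^ 2 := fun y => by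
    have h1 : ∑ v ∈ P, ⟪M v, y⟫_ℝ ^ 2 = ∑ t ∈ P.image M, ⟪t, y⟫_ℝ ^ 2 :=
      (Finset.sum_image (f := fun t : E3 => ⟪t, y⟫_ℝ ^ 2) hinjM).symm
    rw [h1, heq, Finset.sum_image hinjf]
    exact hTiso y
  have hnorm := norm_map_eq_of_isotropic M (by norm_num : (0 : ℝ) < 8) hPiso hMiso
  exact ⟨⟨M, hnorm⟩, fun v hv => hπM v hv⟩

/-- A linear map within `2/5` of an isometry is `3/5`-bounded below. [this file] -/
theorem norm_map_ge_of_near_isometry {X : E3 →ₗ[ℝ] E3} {m : ℝ} (h : ∃ Q : E3 →ₗᵢ[ℝ] E3, ∀ v, ‖X v - Q v‖ ≤ m * ‖v‖) (u : E3) :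
    (1 - m) * ‖u‖ ≤ ‖X u‖ := by
  obtain ⟨Q, hQ⟩ := h
  have h1 := norm_sub_norm_le (Q u) (X u)
  rw [Q.norm_map, ← norm_sub_rev (X u)] at h1
  nlinarith [hQ u]

end PatternRigidProof

end Summit.AtomisticToContinuum.Crystallization.Theorems.OverbindingBudgetAffineFarSmoothSplit
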